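import Summits.QuantumFields.GaugeBoot.SymmetricBootstrapConvergenceZd
import HarnessLib

/-!
# Monotone convergence of the plain and the translation-reduced SDP bounds on `ℤ^d` (gauge-boot, L1/L4 supplement)

HONEST FRAMING (cell `pub-gaugeboot`, page 1 of every file): the venture produces certified bounds
on lattice expectations at stated coupling, gauge group, dimension and torus size; NOT a mass gap,
NOT a continuum limit, NOT a string tension; NOT Yang–Mills-summit-bearing (barriers
`FixedCouplingUltralocality`, `PerturbativeInvisibility`). Structural; it certifies no number
and says nothing about RATES.

## Content (`SU(N)` on the infinite lattice `ℤ^d`, any real `β`, any polynomial observable `P`)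

The `sup`/`inf` form of the two convergence theorems (`bootstrap_convergence_dlr_suN`,
`symBootstrap_convergence_dlr_suN`):

* `dlrValuesSuN N β P = {∫ P dμ : μ Gibbs}`, `invDlrValuesSuN N β P = {∫ P dμ : μ translation-invariant
  Gibbs}` — non-empty, bounded by `‖P‖`, `inv ⊆ dlr`; `dlrValues ⊆ levelValuesZd_n`,
  `invDlrValues ⊆ symLevelValuesZd_n` (soundness at every level); `levelValuesZd_eq_Icc_suN`
  (compact interval), boundedness of both value sets on the certificate domain;
* ★★★ `tendsto_sSup_levelValuesZd_suN` / `tendsto_sInf_levelValuesZd_suN` — the PLAIN level-`n` SDP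
  upper (lower) bound of `P` converges, as `n → ∞`, to the supremum (infimum) of `∫ P dμ` over ALL
  infinite-volume Gibbs states at `β`;
* ★★★ `tendsto_sSup_symLevelValuesZd_suN` / `tendsto_sInf_symLevelValuesZd_suN` — the
  TRANSLATION-REDUCED ("Wilson loops by shape") level-`n` SDP upper (lower) bound converges to the
  supremum (infimum) of `∫ P dμ` over the TRANSLATION-INVARIANT Gibbs states;
* ★★ `sSup_invDlrValues_le_suN` — so `lim reduced upper bound ≤ lim plain upper bound` (and dually);
  ★★ `tendsto_sSup_levelValuesZd_suN_of_small` / `tendsto_sSup_symLevelValuesZd_suN_of_small` — at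
  strong coupling `6(d-1)N|β| < 1` (a unique Gibbs state `ν`) BOTH hierarchies' upper and lower
  bounds converge to the single number `∫ P dν`.

What this is NOT: whether the two limits differ at some `β` (translation-symmetry breaking in
`P`); rates; fixed-level comparisons beyond `BootstrapTranslationReductionZd`.

References: P. Anderson, M. Kruczenski, Nucl. Phys. B 921 (2017); V. Kazakov, Z. Zheng,
arXiv:2203.11360; H.-O. Georgii, Gibbs Measures and Phase Transitions (2011) Ch. 7 (extremal and
invariant Gibbs measures). Folklore.
-/

noncomputable section

open MeasureTheory Filter Topology NormedSpace
open Literature.MathematicalPhysics.QuantumFieldTheory (LatticeRep ymGibbsMeasures_nonempty)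
open Literature.MathematicalPhysics.QuantumLattice

namespace Summit.QuantumFields.GaugeBoot

section ZdSuN

variable {d : ℕ} (N : ℕ) (β : ℝ)

/-- **The expectations of `P` over all infinite-volume Gibbs states.** [folklore] -/
def dlrValuesSuN (P : C(LGConfig d (Matrix.specialUnitaryGroup (Fin N) ℂ), ℝ)) : Set ℝ :=
  {t | ∃ μ ∈ ymGibbsMeasures (d := d) (fundamentalRep (Fin N)) β, ∫ U, P U ∂μ = t}

/-- **The expectations of `P` over the translation-invariant Gibbs states.** [folklore] -/
def invDlrValuesSuN (P : C(LGConfig d (Matrix.specialUnitaryGroup (Fin N) ℂ), ℝ)) : Set ℝ :=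
  {t | ∃ μ ∈ ymGibbsMeasures (d := d) (fundamentalRep (Fin N)) β, IsZdTranslationInvariant μ ∧ ∫ U, P U ∂μ = t}

/-- Invariant Gibbs values are Gibbs values. -/
theorem invDlrValues_subset_dlrValues_suN (P : C(LGConfig d (Matrix.specialUnitaryGroup (Fin N) ℂ), ℝ)) :
    invDlrValuesSuN (d := d) N β P ⊆ dlrValuesSuN (d := d) N β P := by
  rintro t ⟨μ, hμ, -, rfl⟩
  exact ⟨μ, hμ, rfl⟩

/-- An expectation in a Gibbs state is bounded by the sup norm. -/
theorem abs_dlr_integral_le_norm {μ : Measure (LGConfig d (Matrix.specialUnitaryGroup (Fin N) ℂ))}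
    (hμ : μ ∈ ymGibbsMeasures (d := d) (fundamentalRep (Fin N)) β)
    (P : C(LGConfig d (Matrix.specialUnitaryGroup (Fin N) ℂ), ℝ)) : |∫ U, P U ∂μ| ≤ ‖P‖ := by
  haveI := hμ.1
  refine (abs_integral_le_integral_abs).trans ?_
  have h : ∫ U, |P U| ∂μ ≤ ∫ _, ‖P‖ ∂μ :=
    integral_mono (integrable_of_continuous_compact (continuous_abs.comp P.continuous) μ)
      (integrable_const _) fun U => by
        rw [← Real.norm_eq_abs]
        exact ContinuousMap.norm_coe_le_norm P U
  simpa using h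

/-- The Gibbs values form a non-empty bounded set. -/
theorem dlrValues_nonempty_bdd_suN (P : C(LGConfig d (Matrix.specialUnitaryGroup (Fin N) ℂ), ℝ)) :
    (dlrValuesSuN (d := d) N β P).Nonempty ∧ BddAbove (dlrValuesSuN (d := d) N β P) ∧
      BddBelow (dlrValuesSuN (d := d) N β P) := by
  obtain ⟨μ, hμ⟩ := ymGibbsMeasures_nonempty (d := d) (fundamentalRep (Fin N)) (continuous_fundamentalRep _) β
  refine ⟨⟨_, μ, hμ, rfl⟩, ⟨‖P‖, ?_⟩, ⟨-‖P‖, ?_⟩⟩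
  · rintro t ⟨ν, hν, rfl⟩
    exact (abs_le.1 (abs_dlr_integral_le_norm N β hν P)).2
  · rintro t ⟨ν, hν, rfl⟩
    exact (abs_le.1 (abs_dlr_integral_le_norm N β hν P)).1

/-- The invariant Gibbs values form a non-empty bounded set. -/
theorem invDlrValues_nonempty_bdd_suN (P : C(LGConfig d (Matrix.specialUnitaryGroup (Fin N) ℂ), ℝ)) :
    (invDlrValuesSuN (d := d) N β P).Nonempty ∧ BddAbove (invDlrValuesSuN (d := d) N β P) ∧
      BddBelow (invDlrValuesSuN (d := d) N β P) := by
  obtain ⟨ν, hν, hT⟩ := exists_translationInvariant_dlr_suN (d := d) N β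
  obtain ⟨-, hA, hB⟩ := dlrValues_nonempty_bdd_suN N β P
  exact ⟨⟨_, ν, hν, hT, rfl⟩, hA.mono (invDlrValues_subset_dlrValues_suN N β P),
    hB.mono (invDlrValues_subset_dlrValues_suN N β P)⟩

/-- **Soundness at every level (plain)**: Gibbs values are plain level-`n` values. -/
theorem dlrValues_subset_levelValuesZd_suN (n : ℕ) (P : C(LGConfig d (Matrix.specialUnitaryGroup (Fin N) ℂ), ℝ)) :
    dlrValuesSuN (d := d) N β P ⊆ levelValuesZdSuN (d := d) N β n P := by
  rintro t ⟨μ, hμ, rfl⟩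
  haveI := hμ.1
  exact ⟨expectationFunctional μ, isBootstrapFeasible_dlr_suN N β hμ (wordTruncation_subset_polyAlgebra _ n), rfl⟩

/-- **Soundness at every level (reduced)**: invariant Gibbs values are reduced level-`n` values. -/
theorem invDlrValues_subset_symLevelValuesZd_suN (n : ℕ) (P : C(LGConfig d (Matrix.specialUnitaryGroup (Fin N) ℂ), ℝ)) :
    invDlrValuesSuN (d := d) N β P ⊆ symLevelValuesZdSuN (d := d) N β n P := by
  rintro t ⟨μ, hμ, hT, rfl⟩
  exact dlr_integral_mem_symLevelValuesZd N β n hμ hT P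

/-- **The plain level-`n` values of a certificate-domain objective form a compact interval.** -/
theorem levelValuesZd_eq_Icc_suN {n : ℕ} {P : C(LGConfig d (Matrix.specialUnitaryGroup (Fin N) ℂ), ℝ)}
    (hP : P ∈ certDomainZdSuN (d := d) N β n) :
    ∃ lo hi : ℝ, lo ≤ hi ∧ levelValuesZdSuN (d := d) N β n P = Set.Icc lo hi :=
  exists_feasibleValues_eq_Icc (fundamentalLatticeRep N) (wilsonBoundaryAction_polyDeriv_suN N)
    (exists_zdFeasible_suN N β n) hP

/-- Boundedness and non-emptiness of the plain values on the certificate domain. -/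
theorem bdd_levelValuesZd_suN {n : ℕ} {P : C(LGConfig d (Matrix.specialUnitaryGroup (Fin N) ℂ), ℝ)}
    (hP : P ∈ certDomainZdSuN (d := d) N β n) :
    BddAbove (levelValuesZdSuN (d := d) N β n P) ∧ BddBelow (levelValuesZdSuN (d := d) N β n P) ∧
      (levelValuesZdSuN (d := d) N β n P).Nonempty := by
  obtain ⟨lo, hi, hle, h⟩ := levelValuesZd_eq_Icc_suN N β hP
  rw [h]
  exact ⟨bddAbove_Icc, bddBelow_Icc, Set.nonempty_Icc.2 hle⟩

/-- Boundedness and non-emptiness of the reduced values on the certificate domain. -/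
theorem bdd_symLevelValuesZd_suN {n : ℕ} {P : C(LGConfig d (Matrix.specialUnitaryGroup (Fin N) ℂ), ℝ)}
    (hP : P ∈ certDomainZdSuN (d := d) N β n) :
    BddAbove (symLevelValuesZdSuN (d := d) N β n P) ∧ BddBelow (symLevelValuesZdSuN (d := d) N β n P) ∧
      (symLevelValuesZdSuN (d := d) N β n P).Nonempty := by
  obtain ⟨hA, hB, -⟩ := bdd_levelValuesZd_suN N β hP
  exact ⟨hA.mono (symLevelValuesZd_subset_levelValuesZd N β n P),
    hB.mono (symLevelValuesZd_subset_levelValuesZd N β n P), symLevelValuesZd_nonempty N β n P⟩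

/-- A polynomial observable lies in the level-`n` certificate domain for `n` large. -/
theorem eventually_mem_certDomainZd_suN {P : C(LGConfig d (Matrix.specialUnitaryGroup (Fin N) ℂ), ℝ)}
    (hP : P ∈ polyAlgebra (ι := ZdEdge d) (fundamentalLatticeRep N)) :
    ∀ᶠ n in atTop, P ∈ certDomainZdSuN (d := d) N β n := by
  obtain ⟨m, hm⟩ := (eventually_mem_wordTruncation (fundamentalLatticeRep N) hP).exists_forall_of_atTop
  refine eventually_atTop.2 ⟨m, fun n hn => ?_⟩
  exact mem_certDomain_of_mem_wordTruncation _
    (wordTruncation_mono _ (hn.trans (Nat.le_add_right n n)) (hm m le_rfl))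

/-! ### The plain hierarchy: all Gibbs states -/

/-- ★★★ **The plain SDP upper bounds on `ℤ^d` converge to the supremum of `∫ P dμ` over ALL Gibbs
states.** `SU(N)`, any real `β`, any polynomial observable `P`. [folklore] -/
theorem tendsto_sSup_levelValuesZd_suN {P : C(LGConfig d (Matrix.specialUnitaryGroup (Fin N) ℂ), ℝ)}
    (hP : P ∈ polyAlgebra (ι := ZdEdge d) (fundamentalLatticeRep N)) :
    Tendsto (fun n => sSup (levelValuesZdSuN (d := d) N β n P)) atTop
      (𝓝 (sSup (dlrValuesSuN (d := d) N β P))) := by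
  obtain ⟨hDne, hDbdd, -⟩ := dlrValues_nonempty_bdd_suN (d := d) N β P
  set S := sSup (dlrValuesSuN (d := d) N β P)
  rw [Metric.tendsto_atTop]
  intro ε hε
  obtain ⟨n₁, hn₁⟩ := bootstrap_convergence_dlr_suN (d := d) N β
    (fun n => wordTruncation (ι := ZdEdge d) (fundamentalLatticeRep N) n)
    (fun a ha => eventually_mem_wordTruncation (fundamentalLatticeRep N) ha) hP (half_pos hε)
  obtain ⟨n₂, hn₂⟩ := (eventually_mem_certDomainZd_suN N β hP).exists_forall_of_atTop
  refine ⟨max n₁ n₂, fun n hn => ?_⟩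
  obtain ⟨hbdd, -, hne⟩ := bdd_levelValuesZd_suN N β (hn₂ n ((le_max_right _ _).trans hn))
  have hup : sSup (levelValuesZdSuN (d := d) N β n P) ≤ S + ε / 2 := by
    refine csSup_le hne ?_
    rintro t ⟨φ, hφ, rfl⟩
    obtain ⟨μ, hμ, hclose⟩ := hn₁ φ (hφ.mono _ (wordTruncation_mono _ ((le_max_left _ _).trans hn)))
    have h1 : ∫ U, P U ∂μ ≤ S := le_csSup hDbdd ⟨μ, hμ, rfl⟩
    linarith [(abs_le.1 hclose).2]
  have hlow : S ≤ sSup (levelValuesZdSuN (d := d) N β n P) :=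
    csSup_le_csSup hbdd hDne (dlrValues_subset_levelValuesZd_suN N β n P)
  rw [Real.dist_eq, abs_lt]
  constructor <;> linarith

/-- ★★★ **The plain SDP lower bounds on `ℤ^d` converge to the infimum of `∫ P dμ` over all Gibbs
states.** [folklore] -/
theorem tendsto_sInf_levelValuesZd_suN {P : C(LGConfig d (Matrix.specialUnitaryGroup (Fin N) ℂ), ℝ)}
    (hP : P ∈ polyAlgebra (ι := ZdEdge d) (fundamentalLatticeRep N)) :
    Tendsto (fun n => sInf (levelValuesZdSuN (d := d) N β n P)) atTop
      (𝓝 (sInf (dlrValuesSuN (d := d) N β P))) := by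
  obtain ⟨hDne, -, hDbdd⟩ := dlrValues_nonempty_bdd_suN (d := d) N β P
  set S := sInf (dlrValuesSuN (d := d) N β P)
  rw [Metric.tendsto_atTop]
  intro ε hε
  obtain ⟨n₁, hn₁⟩ := bootstrap_convergence_dlr_suN (d := d) N β
    (fun n => wordTruncation (ι := ZdEdge d) (fundamentalLatticeRep N) n)
    (fun a ha => eventually_mem_wordTruncation (fundamentalLatticeRep N) ha) hP (half_pos hε)
  obtain ⟨n₂, hn₂⟩ := (eventually_mem_certDomainZd_suN N β hP).exists_forall_of_atTop
  refine ⟨max n₁ n₂, fun n hn => ?_⟩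
  obtain ⟨-, hbdd, hne⟩ := bdd_levelValuesZd_suN N β (hn₂ n ((le_max_right _ _).trans hn))
  have hlow : S - ε / 2 ≤ sInf (levelValuesZdSuN (d := d) N β n P) := by
    refine le_csInf hne ?_
    rintro t ⟨φ, hφ, rfl⟩
    obtain ⟨μ, hμ, hclose⟩ := hn₁ φ (hφ.mono _ (wordTruncation_mono _ ((le_max_left _ _).trans hn)))
    have h1 : S ≤ ∫ U, P U ∂μ := csInf_le hDbdd ⟨μ, hμ, rfl⟩
    linarith [(abs_le.1 hclose).1]
  have hup : sInf (levelValuesZdSuN (d := d) N β n P) ≤ S :=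
    csInf_le_csInf hbdd hDne (dlrValues_subset_levelValuesZd_suN N β n P)
  rw [Real.dist_eq, abs_lt]
  constructor <;> linarith

/-! ### The reduced hierarchy: the translation-invariant Gibbs states -/

/-- ★★★ **The translation-reduced SDP upper bounds on `ℤ^d` converge to the supremum of `∫ P dμ`
over the TRANSLATION-INVARIANT Gibbs states.** `SU(N)`, any real `β`, any polynomial `P`.
[folklore] -/
theorem tendsto_sSup_symLevelValuesZd_suN {P : C(LGConfig d (Matrix.specialUnitaryGroup (Fin N) ℂ), ℝ)}
    (hP : P ∈ polyAlgebra (ι := ZdEdge d) (fundamentalLatticeRep N)) :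
    Tendsto (fun n => sSup (symLevelValuesZdSuN (d := d) N β n P)) atTop
      (𝓝 (sSup (invDlrValuesSuN (d := d) N β P))) := by
  obtain ⟨hDne, hDbdd, -⟩ := invDlrValues_nonempty_bdd_suN (d := d) N β P
  set S := sSup (invDlrValuesSuN (d := d) N β P)
  rw [Metric.tendsto_atTop]
  intro ε hε
  obtain ⟨n₁, hn₁⟩ := symBootstrap_convergence_dlr_suN (d := d) N β hP (half_pos hε)
  obtain ⟨n₂, hn₂⟩ := (eventually_mem_certDomainZd_suN N β hP).exists_forall_of_atTop
  refine ⟨max n₁ n₂, fun n hn => ?_⟩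
  obtain ⟨hbdd, -, hne⟩ := bdd_symLevelValuesZd_suN N β (hn₂ n ((le_max_right _ _).trans hn))
  have hup : sSup (symLevelValuesZdSuN (d := d) N β n P) ≤ S + ε / 2 := by
    refine csSup_le hne fun t ht => ?_
    obtain ⟨μ, hμ, hT, hclose⟩ :=
      hn₁ t (symLevelValuesZd_anti N β ((le_max_left _ _).trans hn) P ht)
    have h1 : ∫ U, P U ∂μ ≤ S := le_csSup hDbdd ⟨μ, hμ, hT, rfl⟩
    linarith [(abs_le.1 hclose).2]
  have hlow : S ≤ sSup (symLevelValuesZdSuN (d := d) N β n P) :=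
    csSup_le_csSup hbdd hDne (invDlrValues_subset_symLevelValuesZd_suN N β n P)
  rw [Real.dist_eq, abs_lt]
  constructor <;> linarith

/-- ★★★ **The translation-reduced SDP lower bounds on `ℤ^d` converge to the infimum of `∫ P dμ` over
the translation-invariant Gibbs states.** [folklore] -/
theorem tendsto_sInf_symLevelValuesZd_suN {P : C(LGConfig d (Matrix.specialUnitaryGroup (Fin N) ℂ), ℝ)}
    (hP : P ∈ polyAlgebra (ι := ZdEdge d) (fundamentalLatticeRep N)) :
    Tendsto (fun n => sInf (symLevelValuesZdSuN (d := d) N β n P)) atTop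
      (𝓝 (sInf (invDlrValuesSuN (d := d) N β P))) := by
  obtain ⟨hDne, -, hDbdd⟩ := invDlrValues_nonempty_bdd_suN (d := d) N β P
  set S := sInf (invDlrValuesSuN (d := d) N β P)
  rw [Metric.tendsto_atTop]
  intro ε hε
  obtain ⟨n₁, hn₁⟩ := symBootstrap_convergence_dlr_suN (d := d) N β hP (half_pos hε)
  obtain ⟨n₂, hn₂⟩ := (eventually_mem_certDomainZd_suN N β hP).exists_forall_of_atTop
  refine ⟨max n₁ n₂, fun n hn => ?_⟩
  obtain ⟨-, hbdd, hne⟩ := bdd_symLevelValuesZd_suN N β (hn₂ n ((le_max_right _ _).trans hn))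
  have hlow : S - ε / 2 ≤ sInf (symLevelValuesZdSuN (d := d) N β n P) := by
    refine le_csInf hne fun t ht => ?_
    obtain ⟨μ, hμ, hT, hclose⟩ :=
      hn₁ t (symLevelValuesZd_anti N β ((le_max_left _ _).trans hn) P ht)
    have h1 : S ≤ ∫ U, P U ∂μ := csInf_le hDbdd ⟨μ, hμ, hT, rfl⟩
    linarith [(abs_le.1 hclose).1]
  have hup : sInf (symLevelValuesZdSuN (d := d) N β n P) ≤ S :=
    csInf_le_csInf hbdd hDne (invDlrValues_subset_symLevelValuesZd_suN N β n P)
  rw [Real.dist_eq, abs_lt]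
  constructor <;> linarith

/-- ★★ **The reduced limit is below the plain limit** (upper bounds; dually for lower bounds). -/
theorem sSup_invDlrValues_le_suN (P : C(LGConfig d (Matrix.specialUnitaryGroup (Fin N) ℂ), ℝ)) :
    sSup (invDlrValuesSuN (d := d) N β P) ≤ sSup (dlrValuesSuN (d := d) N β P) ∧
      sInf (dlrValuesSuN (d := d) N β P) ≤ sInf (invDlrValuesSuN (d := d) N β P) := by
  obtain ⟨hIne, -, -⟩ := invDlrValues_nonempty_bdd_suN (d := d) N β P
  obtain ⟨-, hA, hB⟩ := dlrValues_nonempty_bdd_suN (d := d) N β P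
  exact ⟨csSup_le_csSup hA hIne (invDlrValues_subset_dlrValues_suN N β P),
    csInf_le_csInf hB hIne (invDlrValues_subset_dlrValues_suN N β P)⟩

/-! ### Strong coupling: both hierarchies converge to the unique Gibbs value -/

/-- At strong coupling the Gibbs values of `P` are the single number `∫ P dν`. -/
theorem dlrValues_eq_singleton_of_small {β : ℝ} (hβ : 6 * ((d - 1 : ℕ) : ℝ) * N * |β| < 1)
    {ν : Measure (LGConfig d (Matrix.specialUnitaryGroup (Fin N) ℂ))}
    (hν : ν ∈ ymGibbsMeasures (d := d) (fundamentalRep (Fin N)) β)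
    (P : C(LGConfig d (Matrix.specialUnitaryGroup (Fin N) ℂ), ℝ)) :
    dlrValuesSuN (d := d) N β P = {∫ U, P U ∂ν} ∧ invDlrValuesSuN (d := d) N β P = {∫ U, P U ∂ν} := by
  have huniq : ∀ μ ∈ ymGibbsMeasures (d := d) (fundamentalRep (Fin N)) β, μ = ν := fun μ hμ =>
    subsingleton_ymGibbsMeasures_allGroups (fundamentalRep (Fin N)) (continuous_fundamentalRep _) hβ hμ hν
  obtain ⟨ν', hν', hT'⟩ := exists_translationInvariant_dlr_suN (d := d) N β
  have hνT : IsZdTranslationInvariant ν := huniq ν' hν' ▸ hT'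
  constructor
  · ext t
    constructor
    · rintro ⟨μ, hμ, rfl⟩
      rw [huniq μ hμ]
      rfl
    · rintro rfl
      exact ⟨ν, hν, rfl⟩
  · ext t
    constructor
    · rintro ⟨μ, hμ, -, rfl⟩
      rw [huniq μ hμ]
      rfl
    · rintro rfl
      exact ⟨ν, hν, hνT, rfl⟩

/-- ★★ **At strong coupling the PLAIN SDP bounds on `ℤ^d` converge to `∫ P dν`** (`ν` the unique
Gibbs state). [folklore] -/
theorem tendsto_sSup_levelValuesZd_suN_of_small {β : ℝ} (hβ : 6 * ((d - 1 : ℕ) : ℝ) * N * |β| < 1)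
    {ν : Measure (LGConfig d (Matrix.specialUnitaryGroup (Fin N) ℂ))}
    (hν : ν ∈ ymGibbsMeasures (d := d) (fundamentalRep (Fin N)) β)
    {P : C(LGConfig d (Matrix.specialUnitaryGroup (Fin N) ℂ), ℝ)}
    (hP : P ∈ polyAlgebra (ι := ZdEdge d) (fundamentalLatticeRep N)) :
    Tendsto (fun n => sSup (levelValuesZdSuN (d := d) N β n P)) atTop (𝓝 (∫ U, P U ∂ν)) ∧
      Tendsto (fun n => sInf (levelValuesZdSuN (d := d) N β n P)) atTop (𝓝 (∫ U, P U ∂ν)) := by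
  have h := (dlrValues_eq_singleton_of_small N hβ hν P).1
  have h1 := tendsto_sSup_levelValuesZd_suN N β hP
  have h2 := tendsto_sInf_levelValuesZd_suN N β hP
  rw [h, csSup_singleton] at h1
  rw [h, csInf_singleton] at h2
  exact ⟨h1, h2⟩

/-- ★★ **At strong coupling the REDUCED SDP bounds on `ℤ^d` converge to the same number `∫ P dν`**:
in the uniqueness window the translation reduction costs nothing in the limit. [folklore] -/
theorem tendsto_sSup_symLevelValuesZd_suN_of_small {β : ℝ} (hβ : 6 * ((d - 1 : ℕ) : ℝ) * N * |β| < 1)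
    {ν : Measure (LGConfig d (Matrix.specialUnitaryGroup (Fin N) ℂ))}
    (hν : ν ∈ ymGibbsMeasures (d := d) (fundamentalRep (Fin N)) β)
    {P : C(LGConfig d (Matrix.specialUnitaryGroup (Fin N) ℂ), ℝ)}
    (hP : P ∈ polyAlgebra (ι := ZdEdge d) (fundamentalLatticeRep N)) :
    Tendsto (fun n => sSup (symLevelValuesZdSuN (d := d) N β n P)) atTop (𝓝 (∫ U, P U ∂ν)) ∧
      Tendsto (fun n => sInf (symLevelValuesZdSuN (d := d) N β n P)) atTop (𝓝 (∫ U, P U ∂ν)) := by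
  have h := (dlrValues_eq_singleton_of_small N hβ hν P).2
  have h1 := tendsto_sSup_symLevelValuesZd_suN N β hP
  have h2 := tendsto_sInf_symLevelValuesZd_suN N β hP
  rw [h, csSup_singleton] at h1
  rw [h, csInf_singleton] at h2
  exact ⟨h1, h2⟩

end ZdSuN

end Summit.QuantumFields.GaugeBoot

end
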